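import Summits.BirchSwinnertonDyer.Rank1Residual.GaloisImage.CyclotomicLevelPTowerFrobenius
import HarnessLib

/-!
# The `p`-layer generated by Frobenius at a Kolyvagin prime, II: the transversal
# `V₀/V₁ = ⟨φ^f⟩ ≃ ℤ/pⁿ` in the currency of `cyclotomicLevelsRat` — file CK-1b of row T-DER-CK
# (THEOREM C's kernel inputs; cell `b2b-bsdres`, team n1011, seat p15 GEN 7;
# skel `cells/n1011/skel/T-DER-CK.md`)

HONEST FRAMING (cell `b2b-bsdres`, run/shared/lean/b2b/bsd-rank1-residual/, verbatim in every
file): the goal of the cell is to DELETE the COMBINATION-SHAPED residual classes of the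
Birch–Swinnerton-Dyer formula for ALL analytic-rank `≤ 1` elliptic curves over `ℚ` — "full BSD
formula for every rank `≤ 1` curve in class `C`" assembled STRICTLY from published theorems — so
that the rank-`≤ 1` remainder becomes exactly the CONSTRUCTION-SHAPED classes, which are TYPED
(missing-input `Prop`s), NOT attempted. This is not "finishing BSD". Team n1011: research route on
the CONSTRUCTION-SHAPED class X4 / §I N11 (route-1 PORT, (P-DER)); TOOL theorems of Galois theory
only (`p` odd; curve-free); 0 defs, 0 named facts, 0 `sorry`; nothing is booked; no mark / label /
flag text moves; census −0.

## What (referee-1 GEN 35, THEOREM C proviso (iv): "the `q`-inert-in-`F_{n+k}/F_n` layer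
## arithmetic is a separate lemma with its own statement")

Data: `L = cyclotomicLevelsRat p S` (`p` odd), a usable place `q` (prime `q′ ≠ p`), an arithmetic
Frobenius `φ` at `q` lying in `L.tameLevel q` (file CK-1a
`Rat.exists_isArithFrobAtPlace_mem_tameLevel`), `f ≠ 0` with `p ∣ q′^f − 1`, `r = v_p(q′^f − 1)` (`≥ 1`),
`V₀ := L.level r t`, `V₁ := L.level (r + n) t` for a finite set `t` of places (`t = rq` or
`t = r` in the application; `q′^f ≡ 1 (mod ℓ′)` for the places `ℓ ≠ q` of `t`) — the layer
`F_{r+n}(t)/F_r(t)` of Perrin-Riou's ascent (Ann. Inst. Fourier 48 (1998), proof of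
Prop. 2.2.5 (ii)).  Then:
* `Rat.frobenius_pow_mem_level` — (d1) `φ^f ∈ V₀`;
* `Rat.frobenius_pow_pow_mem_pLevel_iff` — (d2) `(φ^f)^m ∈ L.pLevel (r+n) ↔ pⁿ ∣ m` (lifting the
  exponent, CK-1a §3), so `χ_{p^{r+n}}(φ^f)` has order `pⁿ`
  (`Rat.orderOf_modNCyclotomicCharacter_frobenius_pow`);
* `Rat.natCard_ker_unitsMap_prime_pow` — `#ker((ℤ/p^{r+n})ˣ → (ℤ/p^r)ˣ) = pⁿ` (`r ≥ 1`);
* (d3) the TRANSVERSAL: every `g ∈ V₀` is `(φ^f)^j · u` with a UNIQUE `j < pⁿ` and `u ∈ V₁`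
  (`Rat.exists_lt_frobenius_pow_inv_mul_mem_level` = ROW T-DER's `hcov` shape,
  `Rat.eq_of_frobenius_pow_inv_mul_mem_pLevel` / `…_mem_level` = `hinj` shape,
  `Rat.existsUnique_lt_frobenius_pow_inv_mul_mem_level`), packaged as the BIJECTION
  `Fin (pⁿ) → V₀ ⧸ V₁.subgroupOf V₀`, `j ↦ (φ^f)^j` (`Rat.bijective_quotientMk_frobenius_pow`, the
  shape of T-DER-INST's `bijective_quotientMk_pow`) — the section through which F2
  `resLe_coresLe_eq_sum` writes `res ∘ Cor_{V₀/V₁}` as `Σ_{i<pⁿ} (φ^f)^i·` (file C0b's `hcor`) —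
  and `Rat.natCard_level_quotient_eq_prime_pow`: `[F_{r+n}(t) : F_r(t)] = pⁿ`; finally
  `Rat.exists_frobenius_pow_datum` DISCHARGES all the hypotheses `hφ hφq hf hft hfp hr` (and `k ≤ r`)
  at a place with `q′ ≡ 1 (mod p^k)`, `k ≥ 1` (a Kolyvagin prime), `f = ∏_{ℓ ∈ t ∖ q} (ℓ′ − 1)` ("`λ ∣ q` is INERT
  of degree `pⁿ`"; Rubin, LNM 1716 Prop. 8.6: "the decomposition group of `𝔮` in `K_∞/K` is
  infinite").
Mechanism: `χ_{p^{n+r}}` maps `Gal(ℚ̄/ℚ(μ_{p^r}))` into `ker((ℤ/p^{r+n})ˣ → (ℤ/p^r)ˣ)` (tree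
`unitsMap_modNCyclotomicCharacter`), a group of order `pⁿ`, which is therefore generated by
`χ(φ^f)`, of order `pⁿ`.  NOT CLAIMED: `p = 2`; base fields other than `ℚ`.
-/

noncomputable section

open Field IsDedekindDomain
open scoped NumberField

namespace Summit.BirchSwinnertonDyer.Rank1Residual.GaloisImage.CyclotomicLevel

open Literature.NumberTheory.GaloisRepresentations

namespace Rat

open Rat.HeightOneSpectrum

variable {p : ℕ} [hp : Fact p.Prime] {S : Set (HeightOneSpectrum (𝓞 ℚ))}

/-- **(d1) `φ^f ∈ V₀ = Gal(ℚ̄/F_r(t))`**: an arithmetic Frobenius `φ` at the usable place `q`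
lying in the tame level at `q` (CK-1a `Rat.exists_isArithFrobAtPlace_mem_tameLevel`) has `φ^f` in
`L.level r t` as soon as `q′^f ≡ 1 (mod p^r)` and `q′^f ≡ 1 (mod ℓ′)` for the places `ℓ ≠ q` of
`t` (`q ∈ t` allowed). [folklore] -/
theorem frobenius_pow_mem_level {q : HeightOneSpectrum (𝓞 ℚ)}
    (hq : q ∈ (cyclotomicLevelsRat p S).primes) {φ : absoluteGaloisGroup ℚ}
    (hφ : IsArithFrobAtPlace ℚ q φ) (hφq : φ ∈ (cyclotomicLevelsRat p S).tameLevel q)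
    (t : Finset (HeightOneSpectrum (𝓞 ℚ))) {f r : ℕ}
    (hft : ∀ ℓ ∈ t, ℓ ≠ q →
      ((primesEquiv q : Nat.Primes) : ℕ) ^ f ≡ 1 [MOD ((primesEquiv ℓ : Nat.Primes) : ℕ)])
    (hfr : ((primesEquiv q : Nat.Primes) : ℕ) ^ f ≡ 1 [MOD p ^ r]) :
    φ ^ f ∈ (cyclotomicLevelsRat p S).level r t := by
  haveI : NeZero (p ^ r) := ⟨pow_ne_zero r hp.out.ne_zero⟩
  rw [EulerSystemLevels.mem_level_iff, cyclotomicLevelsRat_pLevel,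
    pow_mem_rootsOfUnityFixer_iff_of_isArithFrobAtPlace (not_dvd_prime_pow_of_mem_primes hq r) hφ]
  refine ⟨hfr, fun ℓ hℓ => ?_⟩
  by_cases hℓq : ℓ = q
  · subst hℓq
    exact Subgroup.pow_mem _ hφq f
  · haveI : NeZero ((primesEquiv ℓ : Nat.Primes) : ℕ) := ⟨(primesEquiv ℓ).2.ne_zero⟩
    have hne : ¬ ((primesEquiv q : Nat.Primes) : ℕ) ∣ ((primesEquiv ℓ : Nat.Primes) : ℕ) := fun h =>
      hℓq (primesEquiv.injective (Subtype.ext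
        ((Nat.prime_dvd_prime_iff_eq (primesEquiv q).2 (primesEquiv ℓ).2).mp h).symm))
    rw [cyclotomicLevelsRat_tameLevel, pow_mem_rootsOfUnityFixer_iff_of_isArithFrobAtPlace hne hφ]
    exact hft ℓ hℓ hℓq

/-- **(d2) `(φ^f)^m ∈ Gal(ℚ̄/ℚ(μ_{p^{r+n}}))` iff `pⁿ ∣ m`** (`p` odd, `f ≠ 0`, `p ∣ q′^f − 1`,
`r = v_p(q′^f − 1)`): `φ^f` has order exactly `pⁿ` modulo `L.pLevel (r + n)` — "the primes above
`q′` of `ℚ(μ_{p^r})` are INERT in `ℚ(μ_{p^{r+n}})`" (CK-1a §2 + §3). [folklore] -/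
theorem frobenius_pow_pow_mem_pLevel_iff (hp2 : p ≠ 2) {q : HeightOneSpectrum (𝓞 ℚ)}
    (hq : q ∈ (cyclotomicLevelsRat p S).primes) {φ : absoluteGaloisGroup ℚ}
    (hφ : IsArithFrobAtPlace ℚ q φ) {f r : ℕ} (hf : f ≠ 0)
    (hfp : p ∣ ((primesEquiv q : Nat.Primes) : ℕ) ^ f - 1)
    (hr : padicValNat p (((primesEquiv q : Nat.Primes) : ℕ) ^ f - 1) = r) (n m : ℕ) :
    (φ ^ f) ^ m ∈ (cyclotomicLevelsRat p S).pLevel (r + n) ↔ p ^ n ∣ m := by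
  haveI : NeZero (p ^ (r + n)) := ⟨pow_ne_zero _ hp.out.ne_zero⟩
  rw [cyclotomicLevelsRat_pLevel, ← pow_mul,
    pow_mem_rootsOfUnityFixer_iff_of_isArithFrobAtPlace (not_dvd_prime_pow_of_mem_primes hq _) hφ,
    pow_mul, Nat.ModEq.comm, Nat.modEq_iff_dvd' (Nat.one_le_iff_ne_zero.mpr
      (pow_ne_zero m (pow_ne_zero f (primesEquiv q).2.ne_zero))),
    prime_pow_dvd_pow_sub_one_iff hp2 (one_lt_primesEquiv_pow q hf) hfp hr n m]

/-- **`(φ^f)^{pⁿ} ∈ V₁ = Gal(ℚ̄/F_{r+n}(t))`** (the `hφM : φ^M ∈ V₁` of C0b, `M = pⁿ`). [folklore] -/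
theorem frobenius_pow_pow_mem_level (hp2 : p ≠ 2) {q : HeightOneSpectrum (𝓞 ℚ)}
    (hq : q ∈ (cyclotomicLevelsRat p S).primes) {φ : absoluteGaloisGroup ℚ}
    (hφ : IsArithFrobAtPlace ℚ q φ) (hφq : φ ∈ (cyclotomicLevelsRat p S).tameLevel q)
    (t : Finset (HeightOneSpectrum (𝓞 ℚ))) {f r : ℕ} (hf : f ≠ 0)
    (hft : ∀ ℓ ∈ t, ℓ ≠ q →
      ((primesEquiv q : Nat.Primes) : ℕ) ^ f ≡ 1 [MOD ((primesEquiv ℓ : Nat.Primes) : ℕ)])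
    (hfp : p ∣ ((primesEquiv q : Nat.Primes) : ℕ) ^ f - 1)
    (hr : padicValNat p (((primesEquiv q : Nat.Primes) : ℕ) ^ f - 1) = r) (n : ℕ) :
    (φ ^ f) ^ p ^ n ∈ (cyclotomicLevelsRat p S).level (r + n) t := by
  have h0 : φ ^ f ∈ (cyclotomicLevelsRat p S).level r t :=
    frobenius_pow_mem_level hq hφ hφq t hft (primesEquiv_pow_modEq_one_of_padicValNat_eq q hr)
  refine (cyclotomicLevelsRat p S).mem_level_iff.mpr
    ⟨(frobenius_pow_pow_mem_pLevel_iff hp2 hq hφ hf hfp hr n (p ^ n)).mpr dvd_rfl, fun ℓ hℓ => ?_⟩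
  exact Subgroup.pow_mem _ (((cyclotomicLevelsRat p S).mem_level_iff.mp h0).2 ℓ hℓ) _

/-- **The order of `χ_{p^{r+n}}(φ^f)` is `pⁿ`** (`p` odd, `f ≠ 0`, `p ∣ q′^f − 1`,
`r = v_p(q′^f − 1)`; (d2) read through `rootsOfUnityFixer_eq_ker`). [folklore] -/
theorem orderOf_modNCyclotomicCharacter_frobenius_pow (hp2 : p ≠ 2) {q : HeightOneSpectrum (𝓞 ℚ)}
    (hq : q ∈ (cyclotomicLevelsRat p S).primes) {φ : absoluteGaloisGroup ℚ}
    (hφ : IsArithFrobAtPlace ℚ q φ) {f r : ℕ} (hf : f ≠ 0)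
    (hfp : p ∣ ((primesEquiv q : Nat.Primes) : ℕ) ^ f - 1)
    (hr : padicValNat p (((primesEquiv q : Nat.Primes) : ℕ) ^ f - 1) = r) (n : ℕ) :
    haveI : NeZero (p ^ (r + n)) := ⟨pow_ne_zero _ hp.out.ne_zero⟩
    orderOf (modNCyclotomicCharacter ℚ (p ^ (r + n)) (φ ^ f)) = p ^ n := by
  haveI : NeZero (p ^ (r + n)) := ⟨pow_ne_zero _ hp.out.ne_zero⟩
  have key : ∀ m : ℕ, modNCyclotomicCharacter ℚ (p ^ (r + n)) (φ ^ f) ^ m = 1 ↔ p ^ n ∣ m := by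
    intro m
    rw [← map_pow, ← MonoidHom.mem_ker, ← rootsOfUnityFixer_eq_ker, ← cyclotomicLevelsRat_pLevel p S]
    exact frobenius_pow_pow_mem_pLevel_iff hp2 hq hφ hf hfp hr n m
  exact Nat.dvd_antisymm (orderOf_dvd_of_pow_eq_one ((key _).mpr dvd_rfl))
    ((key _).mp (pow_orderOf_eq_one _))

/-- **The kernel of `(ℤ/p^{r+n})ˣ → (ℤ/p^r)ˣ` has order `pⁿ`** for `r ≥ 1` (surjectivity of the
reduction of units, Mathlib `ZMod.unitsMap_surjective`, and `φ(p^k) = p^{k−1}(p − 1)`). [folklore] -/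
theorem natCard_ker_unitsMap_prime_pow {r : ℕ} (hr : 0 < r) (n : ℕ) :
    haveI : NeZero (p ^ (r + n)) := ⟨pow_ne_zero _ hp.out.ne_zero⟩
    Nat.card (ZMod.unitsMap (pow_dvd_pow p (Nat.le_add_right r n)) :
      (ZMod (p ^ (r + n)))ˣ →* (ZMod (p ^ r))ˣ).ker = p ^ n := by
  haveI : NeZero (p ^ (r + n)) := ⟨pow_ne_zero _ hp.out.ne_zero⟩
  haveI : NeZero (p ^ r) := ⟨pow_ne_zero _ hp.out.ne_zero⟩
  set F : (ZMod (p ^ (r + n)))ˣ →* (ZMod (p ^ r))ˣ :=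
    ZMod.unitsMap (pow_dvd_pow p (Nat.le_add_right r n)) with hF
  have hsurj : Function.Surjective F := ZMod.unitsMap_surjective _
  have h1 : Nat.card F.ker * F.ker.index = Nat.card (ZMod (p ^ (r + n)))ˣ :=
    Subgroup.card_mul_index _
  have hcard : ∀ (k : ℕ) [NeZero k], Nat.card (ZMod k)ˣ = k.totient := fun k _ => by
    rw [Nat.card_eq_fintype_card, ZMod.card_units_eq_totient]
  rw [Subgroup.index_ker, MonoidHom.range_eq_top_of_surjective F hsurj, Subgroup.card_top,
    hcard, hcard, Nat.totient_prime_pow hp.out hr,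
    Nat.totient_prime_pow hp.out (Nat.add_pos_left hr n)] at h1
  have e : p ^ (r + n - 1) * (p - 1) = p ^ n * (p ^ (r - 1) * (p - 1)) := by
    rw [← mul_assoc, ← pow_add]
    congr 2
    omega
  rw [e] at h1
  exact mul_right_cancel₀ (mul_ne_zero (pow_ne_zero _ hp.out.ne_zero)
    (Nat.sub_ne_zero_of_lt hp.out.one_lt)) h1

/-- **(d3, `hcov`) TRANSVERSAL — every `g ∈ V₀ = Gal(ℚ̄/F_r(t))` is `(φ^f)^j · u` with `j < pⁿ`
and `u ∈ V₁ = Gal(ℚ̄/F_{r+n}(t))`**: the `p`-layer `F_{r+n}(t)/F_r(t)` is cyclic of degree `pⁿ`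
generated by the Frobenius `φ^f` ("`λ ∣ q` is INERT in it"; Perrin-Riou's `G_n^{n+k} = ⟨φ_λ⟩`,
Rubin's "the decomposition group of `𝔮` in `K_∞/K` is infinite").  Mechanism: `χ_{p^{r+n}}` maps
`Gal(ℚ̄/ℚ(μ_{p^r}))` into `ker((ℤ/p^{r+n})ˣ → (ℤ/p^r)ˣ)` (tree `unitsMap_modNCyclotomicCharacter`),
of order `pⁿ` (`natCard_ker_unitsMap_prime_pow`), which is therefore generated by `χ(φ^f)`, of order
`pⁿ` (`orderOf_modNCyclotomicCharacter_frobenius_pow`).  Binder shape = ROW T-DER's `hcov` (F3a/F3b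
coset form), for any `t` (`t = r` or `t = rq` in C0d). [folklore] -/
theorem exists_lt_frobenius_pow_inv_mul_mem_level (hp2 : p ≠ 2) {q : HeightOneSpectrum (𝓞 ℚ)}
    (hq : q ∈ (cyclotomicLevelsRat p S).primes) {φ : absoluteGaloisGroup ℚ}
    (hφ : IsArithFrobAtPlace ℚ q φ) (hφq : φ ∈ (cyclotomicLevelsRat p S).tameLevel q)
    (t : Finset (HeightOneSpectrum (𝓞 ℚ))) {f r : ℕ} (hf : f ≠ 0)
    (hft : ∀ ℓ ∈ t, ℓ ≠ q →
      ((primesEquiv q : Nat.Primes) : ℕ) ^ f ≡ 1 [MOD ((primesEquiv ℓ : Nat.Primes) : ℕ)])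
    (hfp : p ∣ ((primesEquiv q : Nat.Primes) : ℕ) ^ f - 1)
    (hr : padicValNat p (((primesEquiv q : Nat.Primes) : ℕ) ^ f - 1) = r) (n : ℕ)
    {g : absoluteGaloisGroup ℚ} (hg : g ∈ (cyclotomicLevelsRat p S).level r t) :
    ∃ j < p ^ n, ((φ ^ f) ^ j)⁻¹ * g ∈ (cyclotomicLevelsRat p S).level (r + n) t := by
  classical
  haveI : NeZero (p ^ (r + n)) := ⟨pow_ne_zero _ hp.out.ne_zero⟩
  haveI : NeZero (p ^ r) := ⟨pow_ne_zero _ hp.out.ne_zero⟩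
  have hr0 : 0 < r := by
    rw [← hr]
    exact one_le_padicValNat_of_dvd (Nat.sub_ne_zero_of_lt (one_lt_primesEquiv_pow q hf)) hfp
  have hd : p ^ r ∣ p ^ (r + n) := pow_dvd_pow p (Nat.le_add_right r n)
  set χ := modNCyclotomicCharacter ℚ (p ^ (r + n)) with hχ
  have hx0 : φ ^ f ∈ (cyclotomicLevelsRat p S).level r t :=
    frobenius_pow_mem_level hq hφ hφq t hft (primesEquiv_pow_modEq_one_of_padicValNat_eq q hr)
  -- the kernel `K` of `(ℤ/p^{r+n})ˣ → (ℤ/p^r)ˣ` contains `χ(Gal(ℚ̄/ℚ(μ_{p^r})))`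
  set K := (ZMod.unitsMap hd : (ZMod (p ^ (r + n)))ˣ →* (ZMod (p ^ r))ˣ).ker with hK
  have hmemK : ∀ σ ∈ rootsOfUnityFixer ℚ (p ^ r), χ σ ∈ K := fun σ hσ => by
    rw [hK, MonoidHom.mem_ker, hχ, unitsMap_modNCyclotomicCharacter ℚ hd σ]
    rwa [rootsOfUnityFixer_eq_ker, MonoidHom.mem_ker] at hσ
  have hxK : χ (φ ^ f) ∈ K := hmemK _ ((cyclotomicLevelsRat p S).mem_level_iff.mp hx0).1
  have hgK : χ g ∈ K := hmemK _ ((cyclotomicLevelsRat p S).mem_level_iff.mp hg).1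
  -- `χ(φ^f)` generates `K`: both have order `pⁿ`
  have hord : orderOf (χ (φ ^ f)) = p ^ n :=
    orderOf_modNCyclotomicCharacter_frobenius_pow hp2 hq hφ hf hfp hr n
  have hzp : Subgroup.zpowers (χ (φ ^ f)) = K := by
    refine Subgroup.eq_of_le_of_card_ge ((Subgroup.zpowers_le).mpr hxK) ?_
    rw [hK, natCard_ker_unitsMap_prime_pow hr0 n, Nat.card_zpowers, hord]
  have hmem : χ g ∈ Subgroup.zpowers (χ (φ ^ f)) := hzp ▸ hgK
  rw [(isOfFinOrder_of_finite (χ (φ ^ f))).mem_zpowers_iff_mem_range_orderOf, hord] at hmem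
  obtain ⟨j, hj, hjg⟩ := Finset.mem_image.mp hmem
  refine ⟨j, Finset.mem_range.mp hj, (cyclotomicLevelsRat p S).mem_level_iff.mpr ⟨?_, fun ℓ hℓ => ?_⟩⟩
  · rw [cyclotomicLevelsRat_pLevel, rootsOfUnityFixer_eq_ker, MonoidHom.mem_ker, map_mul, map_inv,
      map_pow, ← hχ, hjg, inv_mul_cancel]
  · exact Subgroup.mul_mem _ (Subgroup.inv_mem _ (Subgroup.pow_mem _
      (((cyclotomicLevelsRat p S).mem_level_iff.mp hx0).2 ℓ hℓ) j))
      (((cyclotomicLevelsRat p S).mem_level_iff.mp hg).2 ℓ hℓ)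

/-- **(d3, `hinj`) the exponent is unique**: if `((φ^f)^{j₁})⁻¹ (φ^f)^{j₂} ∈ Gal(ℚ̄/ℚ(μ_{p^{r+n}}))`
with `j₁, j₂ < pⁿ` then `j₁ = j₂` (`χ(φ^f)` has order `pⁿ`). [folklore] -/
theorem eq_of_frobenius_pow_inv_mul_mem_pLevel (hp2 : p ≠ 2) {q : HeightOneSpectrum (𝓞 ℚ)}
    (hq : q ∈ (cyclotomicLevelsRat p S).primes) {φ : absoluteGaloisGroup ℚ}
    (hφ : IsArithFrobAtPlace ℚ q φ) {f r : ℕ} (hf : f ≠ 0)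
    (hfp : p ∣ ((primesEquiv q : Nat.Primes) : ℕ) ^ f - 1)
    (hr : padicValNat p (((primesEquiv q : Nat.Primes) : ℕ) ^ f - 1) = r) (n : ℕ)
    {j₁ j₂ : ℕ} (hj₁ : j₁ < p ^ n) (hj₂ : j₂ < p ^ n)
    (h : ((φ ^ f) ^ j₁)⁻¹ * (φ ^ f) ^ j₂ ∈ (cyclotomicLevelsRat p S).pLevel (r + n)) : j₁ = j₂ := by
  haveI : NeZero (p ^ (r + n)) := ⟨pow_ne_zero _ hp.out.ne_zero⟩
  have hord := orderOf_modNCyclotomicCharacter_frobenius_pow hp2 hq hφ hf hfp hr n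
  rw [map_pow] at hord
  rw [cyclotomicLevelsRat_pLevel, rootsOfUnityFixer_eq_ker, MonoidHom.mem_ker, map_mul, map_inv,
    inv_mul_eq_one] at h
  simp only [map_pow] at h
  rw [← hord] at hj₁ hj₂
  exact pow_injOn_Iio_orderOf (Set.mem_Iio.2 hj₁) (Set.mem_Iio.2 hj₂) h

/-- **(d3, `hinj`) in the level currency** — binder shape = ROW T-DER's `hinj` (F3a/F3b):
`((φ^f)^{j₁})⁻¹ (φ^f)^{j₂} ∈ L.level (r + n) t` with `j₁, j₂ < pⁿ` forces `j₁ = j₂`. [folklore] -/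
theorem eq_of_frobenius_pow_inv_mul_mem_level (hp2 : p ≠ 2) {q : HeightOneSpectrum (𝓞 ℚ)}
    (hq : q ∈ (cyclotomicLevelsRat p S).primes) {φ : absoluteGaloisGroup ℚ}
    (hφ : IsArithFrobAtPlace ℚ q φ) (t : Finset (HeightOneSpectrum (𝓞 ℚ))) {f r : ℕ} (hf : f ≠ 0)
    (hfp : p ∣ ((primesEquiv q : Nat.Primes) : ℕ) ^ f - 1)
    (hr : padicValNat p (((primesEquiv q : Nat.Primes) : ℕ) ^ f - 1) = r) (n : ℕ)
    {j₁ j₂ : ℕ} (hj₁ : j₁ < p ^ n) (hj₂ : j₂ < p ^ n)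
    (h : ((φ ^ f) ^ j₁)⁻¹ * (φ ^ f) ^ j₂ ∈ (cyclotomicLevelsRat p S).level (r + n) t) : j₁ = j₂ :=
  eq_of_frobenius_pow_inv_mul_mem_pLevel hp2 hq hφ hf hfp hr n hj₁ hj₂
    ((cyclotomicLevelsRat p S).mem_level_iff.mp h).1

/-- **(d3) packaged as `∃!`**: every `g ∈ V₀` determines a unique `j < pⁿ` with
`((φ^f)^j)⁻¹ g ∈ V₁`. [folklore] -/
theorem existsUnique_lt_frobenius_pow_inv_mul_mem_level (hp2 : p ≠ 2)
    {q : HeightOneSpectrum (𝓞 ℚ)} (hq : q ∈ (cyclotomicLevelsRat p S).primes)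
    {φ : absoluteGaloisGroup ℚ} (hφ : IsArithFrobAtPlace ℚ q φ)
    (hφq : φ ∈ (cyclotomicLevelsRat p S).tameLevel q)
    (t : Finset (HeightOneSpectrum (𝓞 ℚ))) {f r : ℕ} (hf : f ≠ 0)
    (hft : ∀ ℓ ∈ t, ℓ ≠ q →
      ((primesEquiv q : Nat.Primes) : ℕ) ^ f ≡ 1 [MOD ((primesEquiv ℓ : Nat.Primes) : ℕ)])
    (hfp : p ∣ ((primesEquiv q : Nat.Primes) : ℕ) ^ f - 1)
    (hr : padicValNat p (((primesEquiv q : Nat.Primes) : ℕ) ^ f - 1) = r) (n : ℕ)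
    {g : absoluteGaloisGroup ℚ} (hg : g ∈ (cyclotomicLevelsRat p S).level r t) :
    ∃! j : ℕ, j < p ^ n ∧ ((φ ^ f) ^ j)⁻¹ * g ∈ (cyclotomicLevelsRat p S).level (r + n) t := by
  obtain ⟨j, hj, hjg⟩ := exists_lt_frobenius_pow_inv_mul_mem_level hp2 hq hφ hφq t hf hft hfp hr n hg
  refine ⟨j, ⟨hj, hjg⟩, fun j' ⟨hj', hj'g⟩ => ?_⟩
  refine eq_of_frobenius_pow_inv_mul_mem_level hp2 hq hφ t hf hfp hr n hj' hj ?_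
  have hmem := Subgroup.mul_mem _ hj'g (Subgroup.inv_mem _ hjg)
  have e : ((φ ^ f) ^ j')⁻¹ * g * (((φ ^ f) ^ j)⁻¹ * g)⁻¹ = ((φ ^ f) ^ j')⁻¹ * (φ ^ f) ^ j := by
    group
  rwa [e] at hmem

/-- **(d3) as a section of `V₀ ⧸ V₁`**: `j ↦ (φ^f)^j · (V₁ ∩ V₀)`, `j < pⁿ`, is a BIJECTION
`Fin (pⁿ) → V₀ ⧸ V₁.subgroupOf V₀` — the section `s` that F2 `resLe_coresLe_eq_sum` consumes to
write `res ∘ Cor_{V₀/V₁}` as `Σ_{i<pⁿ} (φ^f)^i ·` (C0b's `hcor`); shape of T-DER-INST's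
`bijective_quotientMk_pow`. [folklore] -/
theorem bijective_quotientMk_frobenius_pow (hp2 : p ≠ 2)
    {q : HeightOneSpectrum (𝓞 ℚ)} (hq : q ∈ (cyclotomicLevelsRat p S).primes)
    {φ : absoluteGaloisGroup ℚ} (hφ : IsArithFrobAtPlace ℚ q φ)
    (hφq : φ ∈ (cyclotomicLevelsRat p S).tameLevel q)
    (t : Finset (HeightOneSpectrum (𝓞 ℚ))) {f r : ℕ} (hf : f ≠ 0)
    (hft : ∀ ℓ ∈ t, ℓ ≠ q →
      ((primesEquiv q : Nat.Primes) : ℕ) ^ f ≡ 1 [MOD ((primesEquiv ℓ : Nat.Primes) : ℕ)])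
    (hfp : p ∣ ((primesEquiv q : Nat.Primes) : ℕ) ^ f - 1)
    (hr : padicValNat p (((primesEquiv q : Nat.Primes) : ℕ) ^ f - 1) = r) (n : ℕ) :
    Function.Bijective fun j : Fin (p ^ n) ↦
      (QuotientGroup.mk ((⟨φ ^ f, frobenius_pow_mem_level hq hφ hφq t hft
          (primesEquiv_pow_modEq_one_of_padicValNat_eq q hr)⟩ :
          (cyclotomicLevelsRat p S).level r t) ^ (j : ℕ)) :
        (cyclotomicLevelsRat p S).level r t ⧸
          ((cyclotomicLevelsRat p S).level (r + n) t).subgroupOf ((cyclotomicLevelsRat p S).level r t)) := by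
  constructor
  · intro i j hij
    have h := QuotientGroup.eq.mp hij
    rw [Subgroup.mem_subgroupOf, Subgroup.coe_mul, Subgroup.coe_inv, Subgroup.coe_pow,
      Subgroup.coe_pow, Subgroup.coe_mk] at h
    exact Fin.ext (eq_of_frobenius_pow_inv_mul_mem_level hp2 hq hφ t hf hfp hr n i.2 j.2 h)
  · rintro ⟨u⟩
    obtain ⟨j, hj, hju⟩ :=
      exists_lt_frobenius_pow_inv_mul_mem_level hp2 hq hφ hφq t hf hft hfp hr n u.2
    refine ⟨⟨j, hj⟩, ?_⟩
    change QuotientGroup.mk _ = QuotientGroup.mk u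
    refine QuotientGroup.eq.mpr ?_
    rw [Subgroup.mem_subgroupOf, Subgroup.coe_mul, Subgroup.coe_inv, Subgroup.coe_pow, Subgroup.coe_mk]
    exact hju

/-- **The degree of the `p`-layer is `pⁿ`**: `[F_{r+n}(t) : F_r(t)] = #(V₀ ⧸ V₁) = pⁿ`. [folklore] -/
theorem natCard_level_quotient_eq_prime_pow (hp2 : p ≠ 2)
    {q : HeightOneSpectrum (𝓞 ℚ)} (hq : q ∈ (cyclotomicLevelsRat p S).primes)
    {φ : absoluteGaloisGroup ℚ} (hφ : IsArithFrobAtPlace ℚ q φ)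
    (hφq : φ ∈ (cyclotomicLevelsRat p S).tameLevel q)
    (t : Finset (HeightOneSpectrum (𝓞 ℚ))) {f r : ℕ} (hf : f ≠ 0)
    (hft : ∀ ℓ ∈ t, ℓ ≠ q →
      ((primesEquiv q : Nat.Primes) : ℕ) ^ f ≡ 1 [MOD ((primesEquiv ℓ : Nat.Primes) : ℕ)])
    (hfp : p ∣ ((primesEquiv q : Nat.Primes) : ℕ) ^ f - 1)
    (hr : padicValNat p (((primesEquiv q : Nat.Primes) : ℕ) ^ f - 1) = r) (n : ℕ) :
    Nat.card ((cyclotomicLevelsRat p S).level r t ⧸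
      ((cyclotomicLevelsRat p S).level (r + n) t).subgroupOf ((cyclotomicLevelsRat p S).level r t)) =
        p ^ n := by
  rw [← Nat.card_eq_of_bijective _ (bijective_quotientMk_frobenius_pow hp2 hq hφ hφq t hf hft hfp hr n),
    Nat.card_fin]


/-- **The ascent datum exists at a Kolyvagin prime.**  For a usable place `q` with
`q′ ≡ 1 (mod p^k)`, `k ≥ 1` (a Kolyvagin prime of level `k`: `Kato.IsKolyvaginPrime.modEq_one`) and
any finite set `t` of places: there are an arithmetic Frobenius `φ` at `q` in `L.tameLevel q`
(CK-1a §1), an exponent `f ≠ 0` with `q′^f ≡ 1 (mod ℓ′)` for every place `ℓ ≠ q` of `t`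
(`f = ∏_{ℓ ∈ t, ℓ ≠ q} (ℓ′ − 1)`, Fermat), and `r = v_p(q′^f − 1) ≥ k` with `p ∣ q′^f − 1` — i.e.
ALL the hypotheses `hφ hφq hf hft hfp hr` of this file, discharged; the consumer (C0d) only picks
`n` (e.g. `n ≥ v_p(q′ − 1)` for the division step of C0b). [folklore] -/
theorem exists_frobenius_pow_datum (q : HeightOneSpectrum (𝓞 ℚ))
    [DecidableEq (HeightOneSpectrum (𝓞 ℚ))] (t : Finset (HeightOneSpectrum (𝓞 ℚ))) {k : ℕ} (hk : 0 < k)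
    (hqk : ((primesEquiv q : Nat.Primes) : ℕ) ≡ 1 [MOD p ^ k]) :
    ∃ φ : absoluteGaloisGroup ℚ, ∃ f r : ℕ,
      IsArithFrobAtPlace ℚ q φ ∧ φ ∈ (cyclotomicLevelsRat p S).tameLevel q ∧ f ≠ 0 ∧
      (∀ ℓ ∈ t, ℓ ≠ q →
        ((primesEquiv q : Nat.Primes) : ℕ) ^ f ≡ 1 [MOD ((primesEquiv ℓ : Nat.Primes) : ℕ)]) ∧
      p ∣ ((primesEquiv q : Nat.Primes) : ℕ) ^ f - 1 ∧
      padicValNat p (((primesEquiv q : Nat.Primes) : ℕ) ^ f - 1) = r ∧ k ≤ r := by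
  obtain ⟨φ, hφ, hφq⟩ := exists_isArithFrobAtPlace_mem_tameLevel p S q
  set q' : ℕ := ((primesEquiv q : Nat.Primes) : ℕ) with hq'
  set f : ℕ := ∏ ℓ ∈ t.erase q, (((primesEquiv ℓ : Nat.Primes) : ℕ) - 1) with hf
  have hf0 : f ≠ 0 := Finset.prod_ne_zero_iff.mpr fun ℓ _ =>
    Nat.sub_ne_zero_of_lt (primesEquiv ℓ).2.one_lt
  -- `q′^f ≡ 1 (mod ℓ′)` for `ℓ ∈ t`, `ℓ ≠ q` (Fermat's little theorem and `ℓ′ − 1 ∣ f`)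
  have hft : ∀ ℓ ∈ t, ℓ ≠ q → q' ^ f ≡ 1 [MOD ((primesEquiv ℓ : Nat.Primes) : ℕ)] := by
    intro ℓ hℓ hℓq
    have hcop : q'.Coprime ((primesEquiv ℓ : Nat.Primes) : ℕ) :=
      (Nat.coprime_primes (primesEquiv q).2 (primesEquiv ℓ).2).mpr fun h =>
        hℓq (primesEquiv.injective (Subtype.ext h)).symm
    obtain ⟨c, hc⟩ : (((primesEquiv ℓ : Nat.Primes) : ℕ) - 1) ∣ f :=
      Finset.dvd_prod_of_mem _ (Finset.mem_erase.mpr ⟨hℓq, hℓ⟩)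
    rw [hc, pow_mul]
    have h1 := (Nat.ModEq.pow_card_sub_one_eq_one (primesEquiv ℓ).2 hcop).pow c
    rwa [one_pow] at h1
  -- `p^k ∣ q′^f − 1`
  have hpk : p ^ k ∣ q' ^ f - 1 :=
    (Nat.modEq_iff_dvd' (Nat.one_le_iff_ne_zero.mpr (pow_ne_zero f (primesEquiv q).2.ne_zero))).mp
      (by have h := hqk.pow f; rw [one_pow] at h; exact h.symm)
  have hsub : q' ^ f - 1 ≠ 0 := Nat.sub_ne_zero_of_lt (one_lt_primesEquiv_pow q hf0)
  refine ⟨φ, f, padicValNat p (q' ^ f - 1), hφ, hφq, hf0, hft,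
    (dvd_pow_self p hk.ne').trans hpk, rfl, ?_⟩
  exact (padicValNat_dvd_iff_le hsub).mp hpk

end Rat

end Summit.BirchSwinnertonDyer.Rank1Residual.GaloisImage.CyclotomicLevel

end
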